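import Literature.Analysis.Complex.GraphContourDeformation
import HarnessLib

/-!
# Deformation of a real interval into a graph, with holomorphy only above the interval

Topic `Literature/Analysis/Complex` (contour integration). A localised form of
`GraphContourDeformation.lean` (`integral_graph_deformation_eq`): there the integrand `F` had to
be holomorphic on an open set containing the graphs `x + iθ g(x)` over **every** real `x` — in
particular near every real point. When `F` is holomorphic only near the part of the real line
where the contour is actually moved (and its sweep), the identity survives in the form

  `∫ x, ((1 + i g'(x)) • F(x + i g(x)) - F(x)) = 0`     (`integral_graph_deformation_sub_eq_zero`)

provided the support of the `C¹` profile `g` lies in an open interval `(a, b)` and the graphs over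
the closed interval `[a, b]` lie in the open set of holomorphy `U` (nothing is assumed at real
points outside `[a, b]`, where the integrand of the difference vanishes identically). This is the
form needed for space potentials of fields which are analytic near a point only (Grujić–Kukavica
1998; Bradshaw–Grujić–Kukavica 2015, §3: the profile `|y|ψ` vanishes where analyticity is not
known).

Proof: as in `GraphContourDeformation.lean`, with every continuity statement restricted to
`[a, b]`: `Φ(θ) = ∫_a^b ((1 + iθg') • F(x + iθg) - F) dx` has derivative
`∫_a^b ∂ₓ[(i g) • F(x + iθ g)] dx = 0` (`g(a) = g(b) = 0`), so `Φ(1) = Φ(0) = 0`, and the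
integrand of `Φ(1)` vanishes off `(a, b)`.

## References

* Z. Grujić, I. Kukavica, J. Funct. Anal. 152 (1998), §2. [GrujicKukavica1998]
* Z. Bradshaw, Z. Grujić, I. Kukavica, J. Differential Equations 259 (2015), §3. [BradshawGrujicKukavica2015]
* Folklore (Cauchy's theorem for the region between a segment and a graph over it).
-/

noncomputable section

open MeasureTheory Set Function Filter Metric intervalIntegral
open _root_.Topology
open scoped Interval
open _root_.Complex (I)

namespace Literature.Analysis.Complex

variable {E : Type*} [NormedAddCommGroup E] [NormedSpace ℂ E] [CompleteSpace E]

/-! ### Room in the parameter over `[a, b]` -/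

/-- If the graphs `x + iθ g(x)`, `θ ∈ [0,1]`, `x ∈ [a, b]`, of a continuous `g` lie in the open
set `U`, then so do the graphs for `θ` in an open interval around `[0, 1]` (over `[a, b]`).
[folklore] -/
theorem exists_Ioo_graph_subset_Icc {U : Set ℂ} (hU : IsOpen U) {g : ℝ → ℝ} (hg : Continuous g)
    {a b : ℝ}
    (hsweep : ∀ x ∈ Icc a b, ∀ θ ∈ Icc (0 : ℝ) 1, ((x : ℂ) + I * ((θ * g x : ℝ) : ℂ)) ∈ U) :
    ∃ η : ℝ, 0 < η ∧ ∀ x ∈ Icc a b, ∀ θ ∈ Ioo (-η) (1 + η),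
      ((x : ℂ) + I * ((θ * g x : ℝ) : ℂ)) ∈ U := by
  set P : ℝ × ℝ → ℂ := fun q => (q.1 : ℂ) + I * ((q.2 * g q.1 : ℝ) : ℂ) with hP
  have hPc : Continuous P := by
    rw [hP]
    fun_prop
  have hSc : IsCompact (P '' (Icc a b ×ˢ Icc (0 : ℝ) 1)) := (isCompact_Icc.prod isCompact_Icc).image hPc
  have hSU : P '' (Icc a b ×ˢ Icc (0 : ℝ) 1) ⊆ U := by
    rintro _ ⟨⟨x, θ⟩, ⟨hx, hθ⟩, rfl⟩
    exact hsweep x hx θ hθ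
  obtain ⟨δ, hδ, hδU⟩ := hSc.exists_cthickening_subset_open hU hSU
  obtain ⟨C₀, hC₀⟩ := isCompact_Icc.exists_bound_of_continuousOn (s := Icc a b) hg.continuousOn
  set C : ℝ := max C₀ 0 with hCdef
  have hC0 : 0 ≤ C := le_max_right _ _
  have hC : ∀ x ∈ Icc a b, |g x| ≤ C := fun x hx =>
    ((Real.norm_eq_abs _).symm.le.trans (hC₀ x hx)).trans (le_max_left _ _)
  refine ⟨δ / (C + 1), by positivity, fun x hx θ hθ => ?_⟩
  -- clamp `θ` to `[0, 1]`; the two points are `|θ - θ'| |g x| ≤ η C < δ` apart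
  set θ' : ℝ := max 0 (min θ 1) with hθ'
  have hθ'mem : θ' ∈ Icc (0 : ℝ) 1 := ⟨le_max_left _ _, max_le zero_le_one (min_le_right _ _)⟩
  have hdiff : |θ - θ'| ≤ δ / (C + 1) := by
    rw [hθ']
    rcases le_total θ 0 with h0 | h0
    · rw [min_eq_left (h0.trans zero_le_one), max_eq_left h0, sub_zero, abs_of_nonpos h0]
      linarith [hθ.1]
    · rcases le_total θ 1 with h1 | h1
      · rw [min_eq_left h1, max_eq_right h0, sub_self, abs_zero]; positivity
      · rw [min_eq_right h1, max_eq_right zero_le_one, abs_of_nonneg (by linarith)]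
        linarith [hθ.2]
  refine hδU (Metric.mem_cthickening_of_dist_le _ (P (x, θ')) _ _ ⟨(x, θ'), ⟨hx, hθ'mem⟩, rfl⟩ ?_)
  rw [hP]
  simp only [dist_eq_norm]
  rw [show (x : ℂ) + I * ((θ * g x : ℝ) : ℂ) - ((x : ℂ) + I * ((θ' * g x : ℝ) : ℂ)) =
    I * (((θ - θ') * g x : ℝ) : ℂ) by push_cast; ring]
  rw [norm_mul, Complex.norm_I, one_mul, Complex.norm_real, Real.norm_eq_abs, abs_mul]
  calc |θ - θ'| * |g x| ≤ δ / (C + 1) * C :=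
        mul_le_mul hdiff (hC x hx) (abs_nonneg _) (by positivity)
    _ ≤ δ := by
        rw [div_mul_eq_mul_div, div_le_iff₀ (by positivity)]
        nlinarith

/-! ### The derivative of the deformed interval integral vanishes -/

omit [NormedSpace ℂ E] [CompleteSpace E] in
/-- Continuity on `[a, b]` of `x ↦ H(x + iθ g(x))` when the graph over `[a, b]` lies in the set
where `H` is continuous. [folklore] -/
theorem continuousOn_comp_graphPoint_Icc {H : ℂ → E} {U : Set ℂ} (hH : ContinuousOn H U)
    {g : ℝ → ℝ} (hg : Continuous g) {a b : ℝ} {θ : ℝ}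
    (hθ : ∀ x ∈ Icc a b, (x : ℂ) + I * ((θ * g x : ℝ) : ℂ) ∈ U) :
    ContinuousOn (fun x : ℝ => H ((x : ℂ) + I * ((θ * g x : ℝ) : ℂ))) (Icc a b) :=
  hH.comp (by fun_prop : Continuous fun x : ℝ => (x : ℂ) + I * ((θ * g x : ℝ) : ℂ)).continuousOn hθ

omit [NormedSpace ℂ E] [CompleteSpace E] in
/-- Joint continuity in `(θ, x) ∈ T × [a, b]` of `H(x + iθ g(x))`. [folklore] -/
theorem continuousOn_comp_graphPoint_uncurry_Icc {H : ℂ → E} {U : Set ℂ} (hH : ContinuousOn H U)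
    {g : ℝ → ℝ} (hg : Continuous g) {a b : ℝ} {T : Set ℝ}
    (hT : ∀ θ ∈ T, ∀ x ∈ Icc a b, (x : ℂ) + I * ((θ * g x : ℝ) : ℂ) ∈ U) :
    ContinuousOn (fun q : ℝ × ℝ => H ((q.2 : ℂ) + I * ((q.1 * g q.2 : ℝ) : ℂ))) (T ×ˢ Icc a b) :=
  hH.comp (by fun_prop : Continuous fun q : ℝ × ℝ => (q.2 : ℂ) + I * ((q.1 * g q.2 : ℝ) : ℂ)).continuousOn
    fun q hq => hT q.1 hq.1 q.2 hq.2

/-- **The derivative of the deformed interval integral vanishes** (holomorphy above `[a, b]`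
only). Let `F` be holomorphic on an open `U`, `g ∈ C¹` with `g(a) = g(b) = 0` (`a ≤ b`), `S` a
compact set of parameters containing `0` whose graphs over `[a, b]` lie in `U`, and `T ⊆ S` a
neighbourhood of `θ₀`. Then `θ ↦ ∫_a^b ((1 + iθg') • F(x + iθg) - F(x)) dx` has derivative `0` at
`θ₀`. [folklore] -/
theorem hasDerivAt_intervalIntegral_graphIntegrand_Icc {F : ℂ → E} {U : Set ℂ} (hU : IsOpen U)
    (hF : DifferentiableOn ℂ F U) {g : ℝ → ℝ} (hg : ContDiff ℝ 1 g) {a b : ℝ} (hab : a ≤ b)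
    (hga : g a = 0) (hgb : g b = 0) {S T : Set ℝ} (hS : IsCompact S) (hTS : T ⊆ S) {θ₀ : ℝ}
    (hT : T ∈ 𝓝 θ₀) (hθ₀ : θ₀ ∈ T) (h0 : (0 : ℝ) ∈ S)
    (hsweep : ∀ θ ∈ S, ∀ x ∈ Icc a b, (x : ℂ) + I * ((θ * g x : ℝ) : ℂ) ∈ U) :
    HasDerivAt (fun θ : ℝ => ∫ x in a..b, (((1 : ℂ) + I * ((θ * deriv g x : ℝ) : ℂ)) •
        F ((x : ℂ) + I * ((θ * g x : ℝ) : ℂ)) - F (x : ℂ))) 0 θ₀ := by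
  have hgd : Differentiable ℝ g := hg.differentiable (by simp)
  have hg'c : Continuous (deriv g) := hg.continuous_deriv le_rfl
  have hgcont : Continuous g := hg.continuous
  have hFan : AnalyticOnNhd ℂ F U := hF.analyticOnNhd hU
  have hFc : ContinuousOn F U := hF.continuousOn
  have hF'c : ContinuousOn (deriv F) U := hFan.deriv.continuousOn
  have hθ₀S : θ₀ ∈ S := hTS hθ₀
  -- continuity of the pieces on `[a, b]` for `θ ∈ S`
  have hFP : ∀ θ ∈ S, ContinuousOn (fun x : ℝ => F ((x : ℂ) + I * ((θ * g x : ℝ) : ℂ))) (Icc a b) :=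
    fun θ hθ => continuousOn_comp_graphPoint_Icc hFc hgcont (hsweep θ hθ)
  have hF'P : ∀ θ ∈ S, ContinuousOn (fun x : ℝ => deriv F ((x : ℂ) + I * ((θ * g x : ℝ) : ℂ)))
      (Icc a b) :=
    fun θ hθ => continuousOn_comp_graphPoint_Icc hF'c hgcont (hsweep θ hθ)
  have hFreal : ContinuousOn (fun x : ℝ => F (x : ℂ)) (Icc a b) := by
    have h := hFP 0 h0
    simpa using h
  have hsc : ∀ θ : ℝ, Continuous fun x : ℝ => (1 : ℂ) + I * ((θ * deriv g x : ℝ) : ℂ) :=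
    fun θ => by fun_prop
  have hig : Continuous fun x : ℝ => I * ((g x : ℝ) : ℂ) := by fun_prop
  have hig' : Continuous fun x : ℝ => I * ((deriv g x : ℝ) : ℂ) := by fun_prop
  have hDc : ∀ θ ∈ S, ContinuousOn (fun x : ℝ => ((1 : ℂ) + I * ((θ * deriv g x : ℝ) : ℂ)) •
      F ((x : ℂ) + I * ((θ * g x : ℝ) : ℂ)) - F (x : ℂ)) (Icc a b) :=
    fun θ hθ => (((hsc θ).continuousOn).smul (hFP θ hθ)).sub hFreal
  have hD'c : ∀ θ ∈ S, ContinuousOn (fun x : ℝ => ((1 : ℂ) + I * ((θ * deriv g x : ℝ) : ℂ)) •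
      ((I * ((g x : ℝ) : ℂ)) • deriv F ((x : ℂ) + I * ((θ * g x : ℝ) : ℂ))) +
      (I * ((deriv g x : ℝ) : ℂ)) • F ((x : ℂ) + I * ((θ * g x : ℝ) : ℂ))) (Icc a b) :=
    fun θ hθ => (((hsc θ).continuousOn).smul (hig.continuousOn.smul (hF'P θ hθ))).add
      (hig'.continuousOn.smul (hFP θ hθ))
  -- a uniform bound for the derivative on `S × [a, b]`
  have hD'jc : ContinuousOn (fun q : ℝ × ℝ => ((1 : ℂ) + I * ((q.1 * deriv g q.2 : ℝ) : ℂ)) •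
      ((I * ((g q.2 : ℝ) : ℂ)) • deriv F ((q.2 : ℂ) + I * ((q.1 * g q.2 : ℝ) : ℂ))) +
      (I * ((deriv g q.2 : ℝ) : ℂ)) • F ((q.2 : ℂ) + I * ((q.1 * g q.2 : ℝ) : ℂ))) (S ×ˢ Icc a b) := by
    have h1 := continuousOn_comp_graphPoint_uncurry_Icc hFc hgcont hsweep
    have h2 := continuousOn_comp_graphPoint_uncurry_Icc hF'c hgcont hsweep
    have h3 : Continuous fun q : ℝ × ℝ => (1 : ℂ) + I * ((q.1 * deriv g q.2 : ℝ) : ℂ) := by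
      fun_prop
    have h4 : Continuous fun q : ℝ × ℝ => I * ((g q.2 : ℝ) : ℂ) := by fun_prop
    have h5 : Continuous fun q : ℝ × ℝ => I * ((deriv g q.2 : ℝ) : ℂ) := by fun_prop
    exact (h3.continuousOn.smul (h4.continuousOn.smul h2)).add (h5.continuousOn.smul h1)
  obtain ⟨M, hM⟩ := (hS.prod isCompact_Icc).exists_bound_of_continuousOn hD'jc
  -- differentiate under the integral sign
  have hIoc : Ι a b ⊆ Icc a b := by rw [uIoc_of_le hab]; exact Ioc_subset_Icc_self
  have hmeas : ∀ᶠ θ in 𝓝 θ₀, AEStronglyMeasurable (fun x : ℝ =>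
      ((1 : ℂ) + I * ((θ * deriv g x : ℝ) : ℂ)) • F ((x : ℂ) + I * ((θ * g x : ℝ) : ℂ)) - F (x : ℂ))
      (volume.restrict (Ι a b)) := by
    filter_upwards [hT] with θ hθ
    exact ((hDc θ (hTS hθ)).mono hIoc).aestronglyMeasurable measurableSet_uIoc
  have key := intervalIntegral.hasDerivAt_integral_of_dominated_loc_of_deriv_le
    (F := fun θ x => ((1 : ℂ) + I * ((θ * deriv g x : ℝ) : ℂ)) •
      F ((x : ℂ) + I * ((θ * g x : ℝ) : ℂ)) - F (x : ℂ))
    (F' := fun θ x => ((1 : ℂ) + I * ((θ * deriv g x : ℝ) : ℂ)) •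
      ((I * ((g x : ℝ) : ℂ)) • deriv F ((x : ℂ) + I * ((θ * g x : ℝ) : ℂ))) +
      (I * ((deriv g x : ℝ) : ℂ)) • F ((x : ℂ) + I * ((θ * g x : ℝ) : ℂ)))
    (bound := fun _ => M) hT hmeas
    (((hDc θ₀ hθ₀S).mono (by rw [uIcc_of_le hab])).intervalIntegrable)
    (((hD'c θ₀ hθ₀S).mono hIoc).aestronglyMeasurable measurableSet_uIoc)
    (Eventually.of_forall fun x hx θ hθ => hM (θ, x) ⟨hTS hθ, hIoc hx⟩)
    intervalIntegrable_const
    (Eventually.of_forall fun x hx θ hθ =>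
      hasDerivAt_graphIntegrand_param hF hU x θ (hsweep θ (hTS hθ) x (hIoc hx)))
  -- the derivative is `∫_a^b ∂ₓ G = G b - G a = 0`
  have hzero : ∫ x in a..b, (((1 : ℂ) + I * ((θ₀ * deriv g x : ℝ) : ℂ)) •
      ((I * ((g x : ℝ) : ℂ)) • deriv F ((x : ℂ) + I * ((θ₀ * g x : ℝ) : ℂ))) +
      (I * ((deriv g x : ℝ) : ℂ)) • F ((x : ℂ) + I * ((θ₀ * g x : ℝ) : ℂ))) = 0 := by
    rw [integral_eq_sub_of_hasDerivAt
      (fun x hx => hasDerivAt_graphPrimitive_space hF hU hgd θ₀ x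
        (hsweep θ₀ hθ₀S x (by rwa [uIcc_of_le hab] at hx)))
      (((hD'c θ₀ hθ₀S).mono (by rw [uIcc_of_le hab])).intervalIntegrable)]
    simp [hga, hgb]
  have h2 := key.2
  rwa [hzero] at h2

/-! ### The localised deformation theorem -/

/-- **Deformation of a real interval into a graph over it.** Let `F : ℂ → E` be holomorphic on
an open `U ⊆ ℂ`, `g : ℝ → ℝ` of class `C¹` with support in the open interval `(a, b)`, and assume
the graphs `x + iθ g(x)`, `0 ≤ θ ≤ 1`, **over `[a, b]`** lie in `U`. Then
`∫ x, ((1 + i g'(x)) • F(x + i g(x)) - F(x)) = 0` (Bochner integral over `ℝ`; the integrand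
vanishes off `(a, b)`, and nothing is assumed about `F` at other real points). [folklore] -/
theorem integral_graph_deformation_sub_eq_zero {F : ℂ → E} {U : Set ℂ} (hU : IsOpen U)
    (hF : DifferentiableOn ℂ F U) {g : ℝ → ℝ} (hg : ContDiff ℝ 1 g) {a b : ℝ} (hab : a ≤ b)
    (hsupp : tsupport g ⊆ Ioo a b)
    (hsweep : ∀ x ∈ Icc a b, ∀ θ ∈ Icc (0 : ℝ) 1, ((x : ℂ) + I * ((θ * g x : ℝ) : ℂ)) ∈ U) :
    ∫ x : ℝ, (((1 : ℂ) + I * ((deriv g x : ℝ) : ℂ)) • F ((x : ℂ) + I * ((g x : ℝ) : ℂ)) - F (x : ℂ)) = 0 := by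
  have hgcont : Continuous g := hg.continuous
  obtain ⟨η, hη, hsw⟩ := exists_Ioo_graph_subset_Icc hU hgcont hsweep
  -- the integrand difference `D(θ, x)` vanishes off the support of `g`
  have hD0 : ∀ θ x, x ∉ tsupport g → ((1 : ℂ) + I * ((θ * deriv g x : ℝ) : ℂ)) •
      F ((x : ℂ) + I * ((θ * g x : ℝ) : ℂ)) - F (x : ℂ) = 0 := by
    intro θ x hx
    simp only [image_eq_zero_of_notMem_tsupport hx, deriv_eq_zero_of_notMem_tsupport hx,
      mul_zero, Complex.ofReal_zero, add_zero, one_smul, sub_self]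
  have hnot : ∀ x, x ∉ Ioc a b → x ∉ tsupport g := fun x hx hxK =>
    hx (Ioo_subset_Ioc_self (hsupp hxK))
  have hga : g a = 0 := image_eq_zero_of_notMem_tsupport fun h => (lt_irrefl a) (hsupp h).1
  have hgb : g b = 0 := image_eq_zero_of_notMem_tsupport fun h => (lt_irrefl b) (hsupp h).2
  -- `Φ(θ) = ∫_a^b D(θ, x) dx` has derivative `0` on `[0, 1]`, hence `Φ 1 = Φ 0 = 0`
  set S : Set ℝ := Icc (-(η / 2)) (1 + η / 2) with hS
  set T : Set ℝ := Ioo (-(η / 2)) (1 + η / 2) with hT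
  have hSc : IsCompact S := isCompact_Icc
  have hTS : T ⊆ S := Ioo_subset_Icc_self
  have h0S : (0 : ℝ) ∈ S := ⟨by linarith, by linarith⟩
  have hSsw : ∀ θ ∈ S, ∀ x ∈ Icc a b, (x : ℂ) + I * ((θ * g x : ℝ) : ℂ) ∈ U :=
    fun θ hθ x hx => hsw x hx θ ⟨by linarith [hθ.1], by linarith [hθ.2]⟩
  have hΦ' : ∀ θ ∈ uIcc (0 : ℝ) 1, HasDerivAt (fun θ : ℝ => ∫ x in a..b,
      (((1 : ℂ) + I * ((θ * deriv g x : ℝ) : ℂ)) • F ((x : ℂ) + I * ((θ * g x : ℝ) : ℂ)) -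
        F (x : ℂ))) 0 θ := by
    intro θ hθ
    rw [uIcc_of_le zero_le_one] at hθ
    have hθT : θ ∈ T := ⟨by linarith [hθ.1], by linarith [hθ.2]⟩
    exact hasDerivAt_intervalIntegral_graphIntegrand_Icc hU hF hg hab hga hgb hSc hTS
      (isOpen_Ioo.mem_nhds hθT) hθT h0S hSsw
  have hΦ10 := integral_eq_sub_of_hasDerivAt hΦ' intervalIntegrable_const
  simp only [intervalIntegral.integral_zero, zero_mul, Complex.ofReal_zero, mul_zero, add_zero,
    one_smul, sub_self, sub_zero] at hΦ10
  -- `hΦ10 : 0 = Φ 1`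
  have hD1 : ∫ x, (((1 : ℂ) + I * ((1 * deriv g x : ℝ) : ℂ)) •
      F ((x : ℂ) + I * ((1 * g x : ℝ) : ℂ)) - F (x : ℂ)) = 0 := by
    rw [← setIntegral_eq_integral_of_forall_compl_eq_zero (s := Ioc a b)
      (fun x hx => hD0 1 x (hnot x hx)), ← intervalIntegral.integral_of_le hab]
    exact hΦ10.symm
  simpa only [one_mul] using hD1

end Literature.Analysis.Complex
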